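import Summits.QuantumFields.YangMills.Theorems.UnitScaleTiltProp7SPrintStraight
import Literature.MathematicalPhysics.QuantumFieldTheory.Balaban1983to89.B9Eq333ProjectionCovarianceZd
import Literature.MathematicalPhysics.QuantumFieldTheory.Balaban1983to89.B8Eq143PlaqExpansion
import HarnessLib

/-!
# Route `UnitScaleTilt`, crux K1 «MinimiserStabilityRegPr» (stmt-QuantumFields-19200), route-R E′ (A′), package P-A4 CURVED, FILE F2a — THE COMB-AVERAGE DEFECT INDUCTION:
# if the level-`j` block transporters `Ū^j(Γ_{Lz,x′})` of print's iterated gauge-parameter average `Q′_k` ([B9] (3.19), lit `QprimeIter … (bgT …)`) are within `τ_j` of `1` on the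
# `k`-block tower of `y`, then `Q′_k(φ•X)(y) = m•X + O(Σ_j 2τ_j)·m·‖X‖` for every real bump `φ ≥ 0` (`m` = the plain `k`-fold mean of `φ`) — the `M_y = m(1 + E)` row of the
# bump×comb-transport competitor (LOCATEs px11 g5 ∕ px19 g5; pens px12 g5 02:39Z: F2 = px11)

Cell `ym3-torus`, width seat `ym3-torus-px11` (g5; explicit-unit helper).  THEOREMS ONLY (0 `def`, 0 `sorry`); `--supports stmt-QuantumFields-19200`, count-neutral.  YM₃ on T³ is a
ladder rung (R3), not the Clay problem; nothing here claims the stub, the crux, `bern_P`, d = 4 or the mass gap.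

WHAT IS PROVED (ns `…Theorems.Prop7CombAverageDefect`; generic normed algebra `𝔸`, `ℤᵈ` block geometry of `QuantumLattice.BalabanRG`):
`norm_hol_sub_one_le_of_affine` (an affine bond law `A + B|y − q|₁` integrates along words: `|ω|(A + B(|x − q|₁ + |ω|))`),
`l1_sub_of_blockMap`, `l1_natCast_smul`, `sum_blockSites_mul` (block nesting), ★`norm_QprimeIter_smul_sub_le` (the induction on (3.19)), `sum_pow_mul_inv_pow_le_one` (`Σ_{j<k}Lʲ∕Lᵏ ≤ 1`).
The companion `…Prop7CombDefectRowsOfRegPr` discharges the `τ_j` at a printed-regular background.  HONEST SCOPE: bookkeeping; no estimate of print is asserted.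

References: T. Bałaban, CMP **99** (1985) 389–434 [Balaban1985BackgroundPropagators] ((3.18)–(3.19) p.393); CMP **98** (1985) 17–51 [Balaban1985Averaging] ((78)–(80) p.30, pp.24–25).
-/

set_option autoImplicit false

noncomputable section

namespace Summit.QuantumFields.YangMills.Theorems.Prop7CombAverageDefect

open scoped Matrix.Norms.L2Operator BigOperators
open Finset
open Literature.MathematicalPhysics.QuantumFieldTheory.Balaban1983to89
open Literature.MathematicalPhysics.QuantumFieldTheory.Balaban1983to89.T3ContinuumYM3Torus
open Literature.MathematicalPhysics.QuantumFieldTheory.Balaban1983to89.T3PrintedRegularMinimiser (RegPr)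
open Literature.MathematicalPhysics.QuantumLattice (blockMap blockBase blockSites mem_blockSites_iff)
open B7Prop1Explicit renaming Site → LSite
open B7Prop1Explicit (e hol seg treeWord l1 axialFn gaugeAct U1 mem_U1 Letter hol_mem axialFn_mem gaugeAct_mem axial_bond_bound length_treeWord
  norm_inv_sub_one_le hol_cons hol_nil stepHol stepHol_mem l1_add_le l1_vec)
open B7Prop2Explicit (avgIter pdev C0 c2' C0_pos c2'_pos AvgClosed le_pdev unitaryUnits)
open B7Eq78Linearization (conjR conjR_apply QprimeIter zdBlocking Qprime Qprime_apply QprimeIter_succ)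
open B7AvgClosedSpecialUnitarySharp (avgClosed_specialUnitary_of_le_twentyone)
open B7Eq47AveragedBondVsStraight (norm_avgIter_sub_straight_le)
open B7AvgGaugeCovariance (uLev pdev_gaugeAct)
open B8Eq119TwistedAxial (bgT)
open B8Eq143PlaqExpansion (norm_conjR_sub_self_le)
open B10Eq27TorusAxialLog (pull)
open T3SectALandauChart (bgUnits)
open Summit.QuantumFields.YangMills.Theorems.Prop7AxialReprPrint (pdev_pull_lt inAk_pull_of_regPr pull_toUField_mem)

/-! ## §1 Algebra -/

section Algebra

variable {𝔸 : Type*} [NormedRing 𝔸] [NormOneClass 𝔸]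

variable {d : ℕ}

/-- **AFFINE GROWTH INTEGRATES ALONG WORDS**: if `‖V(y, κ) − 1‖ ≤ A + B·|y − q|₁` for all bonds (`A, B ≥ 0`) and `V` has values in `U1`, then along any word `ω` from `x`:
`‖V(ω) − 1‖ ≤ |ω|·(A + B(|x − q|₁ + |ω|))` (the affine twin of lit `B7Prop9General.norm_hol_sub_one_le_of_l1`). [cite: Balaban1985Averaging, pp.24–25] -/
theorem norm_hol_sub_one_le_of_affine {V : LSite d → Fin d → 𝔸ˣ} (hV : ∀ x κ, V x κ ∈ U1 𝔸) (q : LSite d) {A B : ℝ} (hA : 0 ≤ A) (hB : 0 ≤ B)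
    (hb : ∀ (y : LSite d) (κ : Fin d), ‖((V y κ : 𝔸ˣ) : 𝔸) - 1‖ ≤ A + B * l1 (y - q)) :
    ∀ (ω : List (Letter d)) (x : LSite d), ‖((hol V x ω : 𝔸ˣ) : 𝔸) - 1‖ ≤ ω.length * (A + B * (l1 (x - q) + ω.length))
  | [], x => by simp
  | l :: ω, x => by
    rw [hol_cons, Units.val_mul, List.length_cons, Nat.cast_succ]
    have ih := norm_hol_sub_one_le_of_affine hV q hA hB hb ω (x + l.vec)
    have hmove : ∀ y : LSite d, (l1 (y + l.vec - q) : ℝ) ≤ l1 (y - q) + 1 := fun y => by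
      have h1 : y + l.vec - q = (y - q) + l.vec := by abel
      have h2 := l1_add_le (y - q) l.vec
      rw [l1_vec] at h2
      rw [h1]; exact_mod_cast h2
    have hstep : ‖((stepHol V x l : 𝔸ˣ) : 𝔸) - 1‖ ≤ A + B * (l1 (x - q) + 1) := by
      obtain ⟨κ, b⟩ := l
      cases b
      · have hx : x + Letter.vec ((κ, false) : Letter d) = x - e κ := by simp [sub_eq_add_neg]
        rw [show stepHol V x (κ, false) = (V (x + Letter.vec ((κ, false) : Letter d)) κ)⁻¹ from rfl, hx]
        refine (norm_inv_sub_one_le (hV _ _)).trans ((hb _ _).trans ?_)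
        have := hmove x
        rw [hx] at this
        nlinarith
      · rw [B7Prop1Explicit.stepHol_true]
        refine (hb x κ).trans ?_
        nlinarith
    have hn1 : ‖((stepHol V x l : 𝔸ˣ) : 𝔸)‖ ≤ 1 := (mem_U1.mp (stepHol_mem hV x l)).1
    have hlen : (0 : ℝ) ≤ ω.length := Nat.cast_nonneg _
    have hl1 : (0 : ℝ) ≤ l1 (x - q) := Nat.cast_nonneg _
    have hih' : ‖((hol V (x + l.vec) ω : 𝔸ˣ) : 𝔸) - 1‖ ≤ ω.length * (A + B * (l1 (x - q) + 1 + ω.length)) := by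
      refine ih.trans ?_
      have := hmove x
      have h3 : B * (l1 (x + l.vec - q) + ω.length) ≤ B * (l1 (x - q) + 1 + ω.length) := by nlinarith
      nlinarith
    calc _ ≤ ‖((stepHol V x l : 𝔸ˣ) : 𝔸) - 1‖ + ‖((hol V (x + l.vec) ω : 𝔸ˣ) : 𝔸) - 1‖ :=
          B8Ineq170.norm_mul_sub_one_le_of_norm_le_one hn1
      _ ≤ (A + B * (l1 (x - q) + 1)) + ω.length * (A + B * (l1 (x - q) + 1 + ω.length)) := add_le_add hstep hih'
      _ ≤ (ω.length + 1) * (A + B * (l1 (x - q) + (ω.length + 1))) := by nlinarith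

/-- Floor-division geometry: a site of the `N`-block of `y` has every coordinate offset in `[0, N)`, hence `|x − N•y|₁ ≤ d·(N − 1)`. [folklore] -/
theorem l1_sub_of_blockMap {N : ℕ} (hN : 0 < N) {x y : LSite d} (h : blockMap N x = y) :
    l1 (x - (N : ℤ) • y) ≤ d * (N - 1) := by
  have hNz : (0 : ℤ) < N := by exact_mod_cast hN
  have hcoord : ∀ i, 0 ≤ (x - (N : ℤ) • y) i ∧ (x - (N : ℤ) • y) i < N := by
    intro i
    have hi : x i / (N : ℤ) = y i := by rw [← h]; rfl
    have h1 := Int.emod_nonneg (x i) hNz.ne'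
    have h2 := Int.emod_lt_of_pos (x i) hNz
    have h3 := Int.mul_ediv_add_emod (x i) (N : ℤ)   -- N * (x i / N) + x i % N = x i
    rw [hi] at h3
    simp only [Pi.sub_apply, Pi.smul_apply, smul_eq_mul]
    constructor <;> linarith
  unfold l1
  calc ∑ κ, ((x - (N : ℤ) • y) κ).natAbs ≤ ∑ _κ : Fin d, (N - 1) := by
        refine Finset.sum_le_sum fun κ _ => ?_
        have := hcoord κ
        omega
    _ = d * (N - 1) := by simp

/-- `|N•v|₁ = N·|v|₁`. [folklore] -/
theorem l1_natCast_smul (N : ℕ) (v : LSite d) : l1 ((N : ℤ) • v) = N * l1 v := by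
  unfold l1
  rw [Finset.mul_sum]
  refine Finset.sum_congr rfl fun κ _ => ?_
  simp [Int.natAbs_mul]


/-- Block nesting: the `NL`-block of `z` is the disjoint union over the `L`-block of `z` of the `N`-blocks (`⌊⌊x∕N⌋∕L⌋ = ⌊x∕(NL)⌋`). [folklore] -/
theorem sum_blockSites_mul {N L : ℕ} (hN : 0 < N) (hL : 0 < L) (z : LSite d) (g : LSite d → ℝ) :
    ∑ x ∈ blockSites (N * L) z, g x = ∑ x' ∈ blockSites L z, ∑ x ∈ blockSites N x', g x := by
  classical
  haveI : NeZero N := ⟨hN.ne'⟩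
  haveI : NeZero L := ⟨hL.ne'⟩
  haveI : NeZero (N * L) := ⟨(Nat.mul_pos hN hL).ne'⟩
  have hset : blockSites (N * L) z = (blockSites L z).biUnion fun x' => blockSites N x' := by
    ext x
    simp only [Finset.mem_biUnion, mem_blockSites_iff]
    constructor
    · intro hx
      refine ⟨blockMap N x, ?_, rfl⟩
      rw [B7BlockGeometry.blockMap_blockMap, hx]
    · rintro ⟨x', hx', hx⟩
      rw [← B7BlockGeometry.blockMap_blockMap, hx, hx']
  rw [hset, Finset.sum_biUnion]
  intro a _ b _ hab
  simp only [Function.onFun]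
  refine Finset.disjoint_left.mpr fun x hxa hxb => hab ?_
  rw [mem_blockSites_iff] at hxa hxb
  rw [← hxa, ← hxb]

end Algebra

/-! ## §1b ★ The induction: per-level transporter defects ⟹ the iterated comb average of `φ • X` is `(avg φ)•X` up to `Σ 2τ_j` -/

section Induction

variable {𝔸 : Type*} [NormedRing 𝔸] [NormOneClass 𝔸] [NormedAlgebra ℂ 𝔸] [CompleteSpace 𝔸] {d : ℕ}

/-- ★ **THE ITERATED COMB AVERAGE OF A SCALAR BUMP TIMES A CONSTANT.**  For a background `W` whose level-`j` block transporters `T_j(z, x′) = Ū^j(Γ_{Lz,x′})` (lit `bgT`) over the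
`k`-block tower of the level-`k` site `y` lie in `U1` and satisfy `‖T_j(z, x′) − 1‖ ≤ τ_j` (`j < k`), and a real `φ ≥ 0`: for every `j ≤ k` and every level-`j` site `z` under `y`,
`‖(Q′_j(W)(φ•X))(z) − m_j(z)•X‖ ≤ (Σ_{i<j} 2τ_i)·m_j(z)·‖X‖`, `m_j(z) = L^{−dj}·Σ_{x ∈ B^j(z)} φ(x)` — induction on (3.19): each step averages the previous defect (convex, `φ ≥ 0`) and adds
`‖R(T_j)X − X‖ ≤ 2τ_j‖X‖`. [cite: Balaban1985BackgroundPropagators, (3.18)–(3.19) p.393; Balaban1985Averaging, (78)–(80) p.30] -/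
theorem norm_QprimeIter_smul_sub_le {L : ℕ} (hL : 0 < L) (W : LSite d → Fin d → 𝔸ˣ) (k : ℕ) (y : LSite d) (τ : ℕ → ℝ)
    (hT1 : ∀ j < k, ∀ z : LSite d, blockMap (L ^ (k - 1 - j)) z = y → ∀ x' ∈ blockSites L z, bgT L W j z x' ∈ U1 𝔸)
    (hτ : ∀ j < k, ∀ z : LSite d, blockMap (L ^ (k - 1 - j)) z = y → ∀ x' ∈ blockSites L z, ‖(bgT L W j z x' : 𝔸) - 1‖ ≤ τ j)
    (φ : LSite d → ℝ) (hφ : ∀ x, 0 ≤ φ x) (X : 𝔸) :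
    ∀ j ≤ k, ∀ z : LSite d, blockMap (L ^ (k - j)) z = y →
      ‖QprimeIter (zdBlocking d L) (bgT L W) j (fun x => φ x • X) z - ((((L : ℝ) ^ d)⁻¹) ^ j * ∑ x ∈ blockSites (L ^ j) z, φ x) • X‖
        ≤ (∑ i ∈ Finset.range j, 2 * τ i) * ((((L : ℝ) ^ d)⁻¹) ^ j * ∑ x ∈ blockSites (L ^ j) z, φ x) * ‖X‖ := by
  classical
  intro j
  induction j with
  | zero =>
    intro _ z _
    have hb : blockSites (1 : ℕ) z = {z} := by
      ext x; rw [mem_blockSites_iff, Finset.mem_singleton, Literature.MathematicalPhysics.QuantumLattice.blockMap_one]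
    simp [hb]
  | succ j ih =>
    intro hjk z hz
    have hj : j < k := Nat.lt_of_succ_le hjk
    have hLd : (0 : ℝ) < ((L : ℝ) ^ d)⁻¹ := by positivity
    -- the sites of the `L`-block of `z` lie under `y` at level `j`
    have hz' : blockMap (L ^ (k - 1 - j)) z = y := by rwa [show k - 1 - j = k - (j + 1) by omega]
    have hunder : ∀ x' ∈ blockSites L z, blockMap (L ^ (k - j)) x' = y := by
      intro x' hx'
      haveI : NeZero L := ⟨hL.ne'⟩
      rw [mem_blockSites_iff] at hx'
      rw [show k - j = 1 + (k - (j + 1)) by omega, pow_add, pow_one, ← B7BlockGeometry.blockMap_blockMap, hx', ← hz]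
    -- unfold one step of (3.19)
    rw [B7Eq78Linearization.QprimeIter_succ]
    show ‖Qprime (blockSites L z) (fun _ => ((L : ℝ) ^ d)⁻¹) (bgT L W j z) (QprimeIter (zdBlocking d L) (bgT L W) j fun x => φ x • X) -
        ((((L : ℝ) ^ d)⁻¹) ^ (j + 1) * ∑ x ∈ blockSites (L ^ (j + 1)) z, φ x) • X‖ ≤ _
    rw [B7Eq78Linearization.Qprime_apply]
    -- abbreviations
    set mj : LSite d → ℝ := fun x' => (((L : ℝ) ^ d)⁻¹) ^ j * ∑ x ∈ blockSites (L ^ j) x', φ x with hmj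
    have hmj0 : ∀ x', 0 ≤ mj x' := fun x' => by
      rw [hmj]; exact mul_nonneg (pow_nonneg hLd.le _) (Finset.sum_nonneg fun x _ => hφ x)
    have hsum : (((L : ℝ) ^ d)⁻¹) ^ (j + 1) * ∑ x ∈ blockSites (L ^ (j + 1)) z, φ x = ∑ x' ∈ blockSites L z, ((L : ℝ) ^ d)⁻¹ * mj x' := by
      rw [show L ^ (j + 1) = L ^ j * L from pow_succ L j, sum_blockSites_mul (pow_pos hL j) hL z φ, Finset.mul_sum]
      refine Finset.sum_congr rfl fun x' _ => ?_
      rw [hmj]; ring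
    rw [hsum, Finset.sum_smul, ← Finset.sum_sub_distrib]
    -- termwise: `L⁻ᵈ•R(T)(Q_j) − (L⁻ᵈ m_j)•X = L⁻ᵈ•[R(T)(Q_j − m_j•X) + (R(T)(m_j•X) − m_j•X)]`
    have hterm : ∀ x' ∈ blockSites L z,
        ‖((L : ℝ) ^ d)⁻¹ • conjR (bgT L W j z x') (QprimeIter (zdBlocking d L) (bgT L W) j (fun x => φ x • X) x') - (((L : ℝ) ^ d)⁻¹ * mj x') • X‖
          ≤ ((L : ℝ) ^ d)⁻¹ * (((∑ i ∈ Finset.range j, 2 * τ i) + 2 * τ j) * mj x' * ‖X‖) := by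
      intro x' hx'
      have hT := hT1 j hj z hz' x' hx'
      have hτj := hτ j hj z hz' x' hx'
      have hIH := ih hj.le x' (hunder x' hx')
      set Q := QprimeIter (zdBlocking d L) (bgT L W) j (fun x => φ x • X) x' with hQ
      set T := bgT L W j z x' with hTdef
      have hsplit : ((L : ℝ) ^ d)⁻¹ • conjR T Q - (((L : ℝ) ^ d)⁻¹ * mj x') • X
          = ((L : ℝ) ^ d)⁻¹ • (conjR T (Q - mj x' • X) + (conjR T (mj x' • X) - mj x' • X)) := by
        rw [mul_smul, ← smul_sub]
        congr 1
        rw [conjR_apply, conjR_apply, conjR_apply]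
        noncomm_ring
      rw [hsplit, norm_smul, Real.norm_of_nonneg hLd.le]
      refine mul_le_mul_of_nonneg_left ?_ hLd.le
      have h1 : ‖conjR T (Q - mj x' • X)‖ ≤ (∑ i ∈ Finset.range j, 2 * τ i) * mj x' * ‖X‖ :=
        (B8Ineq132.norm_conjR_le hT _).trans hIH
      have h2 : ‖conjR T (mj x' • X) - mj x' • X‖ ≤ 2 * τ j * mj x' * ‖X‖ := by
        refine (norm_conjR_sub_self_le hT _).trans ?_
        rw [norm_smul, Real.norm_of_nonneg (hmj0 x')]
        have := mul_le_mul_of_nonneg_right hτj (mul_nonneg (hmj0 x') (norm_nonneg X))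
        nlinarith [norm_nonneg X, hmj0 x']
      calc _ ≤ ‖conjR T (Q - mj x' • X)‖ + ‖conjR T (mj x' • X) - mj x' • X‖ := norm_add_le _ _
        _ ≤ _ := by nlinarith [h1, h2]
    calc _ ≤ ∑ x' ∈ blockSites L z, ‖((L : ℝ) ^ d)⁻¹ • conjR (bgT L W j z x') (QprimeIter (zdBlocking d L) (bgT L W) j (fun x => φ x • X) x') -
            (((L : ℝ) ^ d)⁻¹ * mj x') • X‖ := norm_sum_le _ _
      _ ≤ ∑ x' ∈ blockSites L z, ((L : ℝ) ^ d)⁻¹ * (((∑ i ∈ Finset.range j, 2 * τ i) + 2 * τ j) * mj x' * ‖X‖) := Finset.sum_le_sum hterm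
      _ = (∑ i ∈ Finset.range (j + 1), 2 * τ i) * (∑ x' ∈ blockSites L z, ((L : ℝ) ^ d)⁻¹ * mj x') * ‖X‖ := by
          rw [Finset.sum_range_succ]
          simp only [Finset.mul_sum, Finset.sum_mul]
          refine Finset.sum_congr rfl fun x' _ => ?_
          ring

end Induction

/-- Geometric level sum: `Σ_{j<k} Lʲ∕Lᵏ ≤ 1` for `L ≥ 2`. [folklore] -/
theorem sum_pow_mul_inv_pow_le_one {L : ℕ} (hL : 2 ≤ L) (k : ℕ) : ∑ j ∈ Finset.range k, (L : ℝ) ^ j * ((L : ℝ) ^ k)⁻¹ ≤ 1 := by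
  have hLr : (2 : ℝ) ≤ L := by exact_mod_cast hL
  have hpos : (0 : ℝ) < (L : ℝ) ^ k := by positivity
  have hgeom : ∀ n : ℕ, ∑ j ∈ Finset.range n, (L : ℝ) ^ j ≤ (L : ℝ) ^ n := by
    intro n
    induction n with
    | zero => simp
    | succ n ih =>
      rw [Finset.sum_range_succ, pow_succ]
      have h0 : (0 : ℝ) ≤ (L : ℝ) ^ n := by positivity
      nlinarith
  rw [← Finset.sum_mul, ← div_eq_mul_inv, div_le_one hpos]
  exact hgeom k


end Summit.QuantumFields.YangMills.Theorems.Prop7CombAverageDefect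

end
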